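import Summits.QuantumFields.YangMills.Theses.BalabanUVNodes
import Summits.QuantumFields.YangMills.Theorems.BalabanUVNodesN27AtAdmReadingOfRecord13CoPHHolderUnitScaleN14Producers

/-!
# BalabanUVNodes ∕ N27 = binder B5 AT THE RECORD, leaf G — K3⁷ `Theses.BalabanUVNodes.SpineGivenEndpointR13SepCoPH` AT THE ADMISSIBLE `CoPH` READING OF RECORD WITH EVERY K4 RATE
# SLOT IN ITS PRODUCER's DEEPEST LANDED CURRENCY, NODE N16 IN ITS CURRENCY OF RECORD «R-β», AND NODE N14 DISCHARGED AT dag-n14-w1's UNIT-SCALE ASSIGNMENT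
# `ne1 := YMDAG.N14.TopBorn.ne1UnitScale l₀ M Λ hM` (the K3⁷ v2 `ne1` pin of record under director-ym №195 (8) reading (a)) — module
# `…N27AtAdmReadingOfRecord13CoPHHolderUnitScaleN14Producers` by name at `N = 2`, `Rg :=` the item's guard `θ.ZhUnity F 2 ∧ θ.SlotsNondegenerate₁₃ F 2`, through XXXVIᶜᵒᵖᴴ
# `spine_rec13CCoPHOn_iff_forall_guarded` and `hc := hP.toCore` — leaf F's twin with `h14` (END-B uniform leaves) replaced by `0 ≤ l₀, 0 ≤ M, 0 ≤ Λ` and the pin `hne1`; a seventh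
# route-facing leaf, nothing may import it
# (cell `pub-ymgap`, HUMAN RULING D-0062 Track A, R134 seat `pub-ymgap-dag-n27-c` (s2) gen 11; `--kind proof --supports stmt-QuantumFields-20544 --as helper`; COUNT-NEUTRAL)

WHAT IS KERNEL-CHECKED ([bookkeeping]; ONE theorem, 0 `def`, 0 `sorry`): ★★ `spineGivenEndpointR13SepCoPH_at_readingAdm₁₃CoPHOn_holder_of_unitScaleN14_c2Bg_thm33Letters : … →
SpineGivenEndpointR13SepCoPH` — THE ITEM as a term under displayed hypotheses = today's K3⁷ reduction BY NAME at node N16's currency of record and node N14's pin of record: a Hölder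
LETTER `β ∈ [0, 1]`; node00-def-W1's admissible tables `S, sp, gauge, T₀, li` with their letters ∕ numerals ((J) `hjunk`, `hnum`, STRIP-(1.18) `hstrip`); the residual data `ne2`, `ne1`;
N14 ⟸ three sign letters `hl₀ hM hΛ` and the reading equation `hne1 : ne1 = ne1UnitScale l₀ M Λ hM …` (dag-n14-w1, reading (a)); N15 ⟸ the reading equation
`hne2 : ne2 = c2BgObjects 3 F.hL b a_S α α' c₃₅ p` (dag-n15-a U-E); N16 at exponent β ⟸ node N06's `B9.Thm33Printed` + dag-n06-b's dictionary (Hölder binder at exponent β) ∕ [4]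
letters + N07's `LeafH3sup` (`hg₃`, `hD`, `h7` — dag-n16-e 40ᴮ §2's text at `N = 2`, letters produced); N17 eliminated; N18 in CLOSED FORM at θ (`h18`); N22 ⟸ N18 (dag-n22-e 8a″
STRIP); (D4) read-out `hD4`; K5 stubs `h20`, `h21` at the guarded spine home and the spine-side representation `hx`; the N19′ edge `h19` reading dag-n16-e 41ᴴ's `RatesHolderAt … β`
for every `ℓ₃`.

HONEST FRAMING.  NOT a discharge: a term of the item's type under displayed hypotheses (audit `proof.conditional`), every one inhabited for no family today (K0⁷
`Record13SepCoPHInhabited` OPEN); the unit-scale reading of node N14 is the director's ADOPTED TABLE READING (a) — the leaf does NOT prove that Bałaban's dressed run is that tower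
(dag-n14-w1 §4 LOCATED); NE2 ∕ NE3 (at exponent β) ∕ NE5 ∕ NE9 ∕ NE7-cluster estimates NOT PROVED here or anywhere in the tree at Bałaban's objects; the N15 family is MODEL-level;
Thm 3.3 ∕ dictionary ∕ letters ∕ `LeafH3sup` are nodes N05∕N06∕N07's open obligations; nothing of Bałaban's asserted or instantiated; N27 COMPOSITE, NOT discharged; K3⁷ NOT claimed
closed; route rev 25 and the skeleton of record UNTOUCHED; counts UNMOVED (typed 28∕28 · discharged 5∕27, A 5∕28); one finite four-torus programme at fixed `ε` — NOT ℝ⁴, NOT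
infinite volume, NOT OS, NOT a mass gap, NOT Clay.  No decl below carries a cite tag.
-/

set_option autoImplicit false

namespace Summit.QuantumFields.YangMills.Theorems.BalabanUVNodesN27SpineRecord

open Set Metric
open scoped Matrix.Norms.L2Operator

open Literature.MathematicalPhysics.QuantumFieldTheory.Balaban1983to89
open Literature.MathematicalPhysics.QuantumFieldTheory.Balaban1983to89.T4Continuum
open Literature.MathematicalPhysics.QuantumFieldTheory.Balaban1983to89.T4OutputRate (Carriers Functional NE5 DecayBound Window)
open Literature.MathematicalPhysics.QuantumFieldTheory.Balaban1983to89.TreeLengthTorus (TDom tsys torusTreeLen)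
open Literature.MathematicalPhysics.QuantumFieldTheory.Balaban1983to89.T4InputCauchyRateData (StepModel)
open Literature.MathematicalPhysics.QuantumFieldTheory.Balaban1983to89.B13Resummation (locE)
open Literature.MathematicalPhysics.QuantumFieldTheory.Balaban1983to89.TreeLengthTorusGeometry (TTouch)
open Literature.MathematicalPhysics.QuantumFieldTheory.Balaban1983to89.B12TreeDecay (K₀)
open Summit.QuantumFields.BalabanUV.T4Continuum.Spine.NE5
open YMDAG.N18.HLayer
open YMDAG.N18.W1Reading (s_N18_rRec₁₃CoPH_readingAdm_of_envelope_bound238_pin n18At_u3OfRecord₁₃_readingAdm_iff)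
open T4ContinuumYM4Torus (ForSmallCouplings)
open Summit.QuantumFields.BalabanUV.T4Continuum.Spine
open YMDAG.UVSplit
open Node00 (Stage13HParams datumOfRecord₁₃CoPH IsRecordOfRecord₁₃CCoPH IsDatumOfRecord₁₃CCoPH NE3Letters₁₁ NE2Objects₁₁ ne3ConstLayerOfRecord₁₁ MatA ιSU prependCoupling)
open Node00.Sect2 (domCount domSys CPair ofBackgroundC)
open Node00.W1 (ReadingData LevelPairing LetterInputs ClusterTower pairOfRecord functionalC termC box SpRestr AdmBg)
open YMDAG.N22 (s_N22_readingOfRecord₁₃CoPH_ofRecordAdm_of_s_N18_analytic s_N22_readingOfRecord₁₃CoPHOn_ofRecordAdm_of_s_N18_stripBound)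
open B7Prop1Explicit B7Prop2Explicit
open B8Ineq132 (InAk covDerivFwd)
open B8LeafModelZd (ZdIdx)
open B8SockLettersRD (SockLettersRD)
open B7Eq78Linearization (zdBlocking QprimeIter)
open B8Eq119TwistedAxial (bgT)
open B8Eq140Level (SideTouches)
open B8Eq138LandauZd (covLap QT)
open B8Eq1117Concrete (XSpace)
open B8Prop5ContractionKLevel (Bd2)
open B8LambdaSpaceKLevel (wt)
open B9SupplySockB9P3ZdLetters (OpsZd)
open B9SupplySockB9P3ZdAt (DictAt Prop6At InvAt CurvAt LandauAt AvgAt HolderAt)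
open Node00 (ne3NperOfRecord₁₁ ne3DomOfRecord₁₁)
open Summit.QuantumFields.BalabanUV.T4Continuum.NE3.LeafIndexSockets (LeafH3sup)
open YMDAG.N14.TopBorn (ne1UnitScale)
open Summit.QuantumFields.YangMills.BalabanUVNodes.N15.AtKeyedHome (neZero_blockFactor)
open Summit.QuantumFields.YangMills.BalabanUVNodes.N15.UnitLayerBg (c2BgObjects)
open Summit.QuantumFields.YangMills.BalabanUVNodes.N15.AtReadingOfRecord13CoPH (s_N15_readingOfRecord₁₃CoPH_of_c2Bg_family s_N15_readingOfRecord₁₃CoPHOn_of_c2Bg_family)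
open Summit.QuantumFields.YangMills.BalabanUVNodes.SpineRatesHolder (RatesHolderAt)
open Summit.QuantumFields.YangMills.BalabanUVNodes.N16OfThm33LettersAllTorusAtRecord13CoPH (exists_letters_s_N16Holder_readingOfRecord₁₃CoPHOn_of_thm33Letters_allTorus)
open Summit.QuantumFields.YangMills.Theses.BalabanUVNodes (SpineGivenEndpointR13SepCoPH)

variable (cr₁₃ : SpineReading₁₃CoPH 2)
  
  (S : (F : T4Family) → (θ : Stage13HParams F 2) → (k : ℕ) → ClusterTower (F.P k) (MatA 2) θ.τ9.M)
  (sp : (F : T4Family) → (θ : Stage13HParams F 2) → (k j : ℕ) → (domSys (F.P k) θ.τ9.M j).Dom → Set (CPair (F.P k) (MatA 2)))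
  (gauge : (F : T4Family) → (θ : Stage13HParams F 2) → (k : ℕ) → GaugeField (F.P k) 0 (Node00.SU 2) → GaugeField (F.P k) 0 (Node00.SU 2) → ℝ)
  (hg : ∀ (F : T4Family) (θ : Stage13HParams F 2) (k : ℕ) (U U' : GaugeField (F.P k) 0 (Node00.SU 2)), 0 ≤ gauge F θ k U U')
  (T₀ : (F : T4Family) → (θ : Stage13HParams F 2) → (k : ℕ) → GaugeField (F.P (k + 1)) 0 (Node00.SU 2) → GaugeField (F.P k) 0 (Node00.SU 2))
  (hT₀ : ∀ (F : T4Family) (θ : Stage13HParams F 2) (k : ℕ) (U : GaugeField (F.P (k + 1)) 0 (Node00.SU 2)),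
    (∀ (j : ℕ) (Y : (domSys (F.P (k + 1)) θ.τ9.M j).Dom), ofBackgroundC (ιSU 2) U ∈ sp F θ (k + 1) j Y) →
      ∀ (j : ℕ) (X : (domSys (F.P k) θ.τ9.M j).Dom), ofBackgroundC (ιSU 2) (T₀ F θ k U) ∈ sp F θ k j X)
  (li : (F : T4Family) → Stage13HParams F 2 → LetterInputs)
  (ne2 : (F : T4Family) → Stage13HParams F 2 → (ℕ → ℝ) → List (ULoop F) → ℕ → NE2Objects₁₁)
  (ne1 : (F : T4Family) → Stage13HParams F 2 → (ℕ → ℝ) → List (ULoop F) → NE1pCarriers)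

/-- ★★ **K3⁷ AT THE ADMISSIBLE `CoPH` READING OF RECORD WITH EVERY K4 RATE SLOT IN ITS PRODUCER's DEEPEST LANDED CURRENCY, NODE N16 IN ITS CURRENCY OF RECORD R-β, AND NODE N14
DISCHARGED AT THE UNIT-SCALE ASSIGNMENT** (`N = 2`; leaf F's twin over (T2) `…HolderUnitScaleN14Producers`): N14 ⟸ `0 ≤ l₀, 0 ≤ M, 0 ≤ Λ` and the pin `hne1` onto dag-n14-w1's
`ne1UnitScale l₀ M Λ hM` (reading (a)), N15 ⟸ the c2Bg reading equation, N16 at exponent β ⟸ node N06's Theorem 3.3 + dictionary + letters + N07's leaf (letters produced), N17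
eliminated, N18 in closed form on node00-def-W1's admissible tables, N22 ⟸ N18 (8a″ STRIP), (D4), the K5 stubs at the guarded spine home and the spine-side representation, the N19′
edge reading `RatesHolderAt … β` for every `ℓ₃` — the guard `θ.ZhUnity F 2 ∧ θ.SlotsNondegenerate₁₃ F 2` reaching every θ-keyed hypothesis.  NOT a discharge: a term of the item's
type under displayed hypotheses, each inhabited for no family today; nothing of Bałaban's run is asserted to be the unit-scale tower. [bookkeeping] -/
theorem spineGivenEndpointR13SepCoPH_at_readingAdm₁₃CoPHOn_holder_of_unitScaleN14_c2Bg_thm33Letters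
    {β : ℝ} (hβ0 : 0 ≤ β) (hβ1 : β ≤ 1) {g₃ : T4Family → ℝ} (hg₃ : ∀ F, 0 < g₃ F)
  (hD : ∀ F : T4Family, letI : CStarAlgebra (Matrix (Fin 2) (Fin 2) ℂ) := {}
      ∃ (len : Site 4 → ℝ) (I : Type) (geo : I → B9.Geometry) (bg : I → B9.Backgrounds) (GA Gp : ∀ i, B9.KernelFamily (geo i) (bg i)) (c35 : ℝ)
        (mem : ℝ → ZdIdx 4 F.L → ℕ → I)
        (ιCfg : ∀ (M : ℝ) (i : ZdIdx 4 F.L) (m : ℕ) (U₀ : Site 4 → Fin 4 → (Matrix (Fin 2) (Fin 2) ℂ)ˣ), (∀ x κ, U₀ x κ ∈ unitaryUnits (Matrix (Fin 2) (Fin 2) ℂ)) → (bg (mem M i m)).Cfg)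
        (ιLoc : ∀ (M : ℝ) (i : ZdIdx 4 F.L) (m : ℕ), (Site 4 → Fin 4 → Matrix (Fin 2) (Fin 2) ℂ) → (geo (mem M i m)).Loc)
        (ops : ℝ → ZdIdx 4 F.L → ℕ → OpsZd 4 (Matrix (Fin 2) (Fin 2) ℂ)) (c₆ K₆ M₃ a₃ c69 q CH B₀'H B₂' BG BR cL : ℝ),
        (∀ v : Site 4, 0 < len v → 1 ≤ len v) ∧ (∀ μ : Fin 4, len (e μ) = 1) ∧
        B9.Thm33Printed c35 geo bg Gp GA ∧
        0 < c₆ ∧ 0 < K₆ ∧ 0 < a₃ ∧ 0 ≤ c69 ∧ 0 ≤ q ∧ 0 < B₀'H ∧ 0 ≤ B₂' ∧ 0 ≤ BG ∧ 0 ≤ BR ∧ 0 < cL ∧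
        (∀ (M : ℝ) (i : {i : ZdIdx 4 F.L // (∀ j, i.Ω j = Set.univ) ∧ (∀ m j, i.Λs m j = {_y | j = m}) ∧ (∀ m j, i.Λb m j = {_c | j = m}) ∧ i.η = ((F.L : ℝ)⁻¹) ^ i.k}) (m : ℕ), DictAt geo bg GA F.L mem ιCfg ιLoc ops M i.1 m) ∧
        (∀ (M : ℝ) (i : {i : ZdIdx 4 F.L // (∀ j, i.Ω j = Set.univ) ∧ (∀ m j, i.Λs m j = {_y | j = m}) ∧ (∀ m j, i.Λb m j = {_c | j = m}) ∧ i.η = ((F.L : ℝ)⁻¹) ^ i.k}) (m : ℕ), M₃ ≤ M → Prop6At bg F.L mem ιCfg c35 c₆ K₆ M i.1 m) ∧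
        (∀ (M : ℝ) (i : {i : ZdIdx 4 F.L // (∀ j, i.Ω j = Set.univ) ∧ (∀ m j, i.Λs m j = {_y | j = m}) ∧ (∀ m j, i.Λb m j = {_c | j = m}) ∧ i.η = ((F.L : ℝ)⁻¹) ^ i.k}) (m : ℕ), M₃ ≤ M → InvAt bg F.L mem ιCfg ops c35 a₃ M i.1 m) ∧
        (∀ (M : ℝ) (i : {i : ZdIdx 4 F.L // (∀ j, i.Ω j = Set.univ) ∧ (∀ m j, i.Λs m j = {_y | j = m}) ∧ (∀ m j, i.Λb m j = {_c | j = m}) ∧ i.η = ((F.L : ℝ)⁻¹) ^ i.k}) (m : ℕ), M₃ ≤ M → CurvAt bg F.L mem ιCfg ops c35 a₃ c69 M i.1 m) ∧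
        (∀ (M : ℝ) (i : {i : ZdIdx 4 F.L // (∀ j, i.Ω j = Set.univ) ∧ (∀ m j, i.Λs m j = {_y | j = m}) ∧ (∀ m j, i.Λb m j = {_c | j = m}) ∧ i.η = ((F.L : ℝ)⁻¹) ^ i.k}) (m : ℕ), M₃ ≤ M → LandauAt bg F.L mem ιCfg ops c35 a₃ M i.1 m) ∧
        (∀ (M : ℝ) (i : {i : ZdIdx 4 F.L // (∀ j, i.Ω j = Set.univ) ∧ (∀ m j, i.Λs m j = {_y | j = m}) ∧ (∀ m j, i.Λb m j = {_c | j = m}) ∧ i.η = ((F.L : ℝ)⁻¹) ^ i.k}) (m : ℕ), AvgAt F.L ops q M i.1 m) ∧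
        (∀ (M : ℝ) (i : {i : ZdIdx 4 F.L // (∀ j, i.Ω j = Set.univ) ∧ (∀ m j, i.Λs m j = {_y | j = m}) ∧ (∀ m j, i.Λb m j = {_c | j = m}) ∧ i.η = ((F.L : ℝ)⁻¹) ^ i.k}) (m : ℕ), HolderAt geo bg GA F.L mem ιCfg ops β len CH M i.1 m) ∧
        (∀ i : {i : ZdIdx 4 F.L // (∀ j, i.Ω j = Set.univ) ∧ (∀ m j, i.Λs m j = {_y | j = m}) ∧ (∀ m j, i.Λb m j = {_c | j = m}) ∧ i.η = ((F.L : ℝ)⁻¹) ^ i.k}, SockLettersRD (𝔸 := Matrix (Fin 2) (Fin 2) ℂ) F.L BG BR B₀'H B₂' cL i.1.η i.1.k i.1.Ω i.1.Λs) ∧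
        (∀ i : {i : ZdIdx 4 F.L // (∀ j, i.Ω j = Set.univ) ∧ (∀ m j, i.Λs m j = {_y | j = m}) ∧ (∀ m j, i.Λb m j = {_c | j = m}) ∧ i.η = ((F.L : ℝ)⁻¹) ^ i.k}, ∀ α₀ : ℝ, 0 < α₀ → α₀ ≤ cL → ∀ U₀ : Site 4 → Fin 4 → (Matrix (Fin 2) (Fin 2) ℂ)ˣ, (∀ x κ, U₀ x κ ∈ unitaryUnits (Matrix (Fin 2) (Fin 2) ℂ)) →
          InAk F.L i.1.k i.1.η α₀ i.1.Ω U₀ →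
          ∃ (g Δ : (Site 4 → Matrix (Fin 2) (Fin 2) ℂ) →ₗ[ℂ] (Site 4 → Matrix (Fin 2) (Fin 2) ℂ)) (q : (Site 4 → Matrix (Fin 2) (Fin 2) ℂ) →ₗ[ℂ] (ℕ → Site 4 → Matrix (Fin 2) (Fin 2) ℂ))
            (qs : (ℕ → Site 4 → Matrix (Fin 2) (Fin 2) ℂ) →ₗ[ℂ] (Site 4 → Matrix (Fin 2) (Fin 2) ℂ)) (Aw c : (ℕ → Site 4 → Matrix (Fin 2) (Fin 2) ℂ) →ₗ[ℂ] (ℕ → Site 4 → Matrix (Fin 2) (Fin 2) ℂ))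
            (H' : XSpace 4 i.1.k (Matrix (Fin 2) (Fin 2) ℂ) →ₗ[ℂ] (Site 4 → Matrix (Fin 2) (Fin 2) ℂ)),
            (∀ x : Site 4 → Matrix (Fin 2) (Fin 2) ℂ, (∃ C : ℝ, ∀ y, ‖x y‖ ≤ C) → g (Δ x + qs (Aw (q x))) = x) ∧ (∀ φ, qs (c (q (g (g (qs φ))))) = qs φ) ∧
            (∀ (f : Site 4 → Matrix (Fin 2) (Fin 2) ℂ), ∀ x ∈ i.1.Ω 0, Δ f x = covLap i.1.η U₀ ((i.1.Ω 0).indicator f) x) ∧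
            (∀ (μ : ℕ → Site 4 → Matrix (Fin 2) (Fin 2) ℂ), ∀ x ∈ i.1.Ω 0, qs μ x = QT F.L i.1.k (i.1.Λs i.1.k) U₀ μ x) ∧
            (∀ (f : Site 4 → Matrix (Fin 2) (Fin 2) ℂ) (n : ℕ), n ≤ i.1.k → ∀ y ∈ i.1.Λs i.1.k n, q f n y = QprimeIter (zdBlocking 4 F.L) (bgT F.L U₀) n f y) ∧
            (∀ (f : Site 4 → Matrix (Fin 2) (Fin 2) ℂ) (n : ℕ) (y : Site 4), ¬ (n ≤ i.1.k ∧ y ∈ i.1.Λs i.1.k n) → q f n y = 0) ∧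
            (∀ (X : XSpace 4 i.1.k (Matrix (Fin 2) (Fin 2) ℂ)) (x : Site 4), ‖H' X x‖ ≤ B₀'H * ‖X‖) ∧
            (∀ n, n ≤ i.1.k → ∀ (X : XSpace 4 i.1.k (Matrix (Fin 2) (Fin 2) ℂ)), ∀ p ∈ {b : Site 4 × Fin 4 | SideTouches (i.1.Ω n) b.1 b.2},
              wt F.L i.1.η n * ‖covDerivFwd i.1.η U₀ p.2 (H' X) p.1‖ ≤ B₀'H * ‖X‖) ∧
            (∀ X : XSpace 4 i.1.k (Matrix (Fin 2) (Fin 2) ℂ), Bd2 F.L i.1.η i.1.k i.1.Ω (covLap i.1.η U₀ (H' X)) (B₂' * ‖X‖)) ∧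
            (∀ (Y : XSpace 4 i.1.k (Matrix (Fin 2) (Fin 2) ℂ)) (n : ℕ) (hn : n ≤ i.1.k) (y : Site 4), y ∈ i.1.Λs i.1.k n →
              QprimeIter (zdBlocking 4 F.L) (bgT F.L U₀) n (H' Y) y = Y (⟨n, Nat.lt_succ_of_le hn⟩, y)) ∧
            (∀ (f : Site 4 → Matrix (Fin 2) (Fin 2) ℂ) (r : ℝ), 0 ≤ r → Bd2 F.L i.1.η i.1.k i.1.Ω f r →
              (∀ x, ‖g f x‖ ≤ BG * r) ∧ ∀ n, n ≤ i.1.k → ∀ p ∈ {b : Site 4 × Fin 4 | SideTouches (i.1.Ω n) b.1 b.2},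
                wt F.L i.1.η n * ‖covDerivFwd i.1.η U₀ p.2 (g f) p.1‖ ≤ BG * r) ∧
            (∀ (f : Site 4 → Matrix (Fin 2) (Fin 2) ℂ) (r : ℝ), 0 ≤ r → Bd2 F.L i.1.η i.1.k i.1.Ω f r → Bd2 F.L i.1.η i.1.k i.1.Ω (f - g (qs (c (q (g f))))) (BR * r))))
  (h7 : ∀ F : T4Family, ∃ C ε₀ : ℝ, 0 ≤ C ∧ 0 < ε₀ ∧ ∀ ε : ℝ, 0 < ε → ε ≤ ε₀ →
      LeafH3sup 4 F.L (ne3NperOfRecord₁₁ F 0 0) ε (C * ε) (C * ε) (ne3DomOfRecord₁₁ F 2 0 0))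
    {l₀ M Λ : ℝ} (hl₀ : 0 ≤ l₀) (hM : 0 ≤ M) (hΛ : 0 ≤ Λ) {b aS : ℝ} (hb : 0 < b) (haS : 0 < aS) {c35 : ℝ} (hc35 : 0 < c35) (α α' : Fin 4) (p : ℝ)
    (h18 : ∀ (F : T4Family) (θ : Stage13HParams F 2), θ.Provisos₁₃CoPH F 2 → (θ.ZhUnity F 2 ∧ θ.SlotsNondegenerate₁₃ F 2) → θ.Admissible F 2 → ∀ (k : ℕ) (b : ℝ), 0 < b → b ≤ θ.γ →
      ∀ g ∈ Window θ.γ,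
        ∀ (U : {U : GaugeField (F.P (k + 1)) 0 (Node00.SU 2) //
            ∀ (j : ℕ) (Y : (domSys (F.P (k + 1)) θ.τ9.M j).Dom), ofBackgroundC (ιSU 2) U ∈ sp F θ (k + 1) j Y})
          (X : Node00.W1.Dom (F.P k) θ.τ9.M),
        |(functionalC (S F θ k) g (ofBackgroundC (ιSU 2) (T₀ F θ k U.1)) X).re -
            (functionalC (S F θ (k + 1)) (prependCoupling b g) (ofBackgroundC (ιSU 2) U.1) (pairOfRecord F θ.τ9.M k X)).re| ≤
          (li F θ).C₅ * (li F θ).θ₅ ^ X.1 * Real.exp (-((li F θ).κ * (domSys (F.P k) θ.τ9.M X.1).dj X.2)))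
    -- N22 ⟸ N18 (dag-n22-e module 8a″, STRIP currency on the reading's OWN table, NO readings clause): (J), twelve numerals, STRIP-(1.18) — verbatim
    (hjunk : ∀ (F : T4Family) (θ : Stage13HParams F 2), θ.Provisos₁₃CoPH F 2 → (θ.ZhUnity F 2 ∧ θ.SlotsNondegenerate₁₃ F 2) → θ.Admissible F 2 →
      ∀ (k : ℕ) (X : Node00.W1.Dom (F.P k) θ.τ9.M), k < X.1 → ∀ (g : ℕ → ℝ) (φ : CPair (F.P k) (MatA 2)), functionalC (S F θ k) g φ X = 0)
    (hnum : ∀ (F : T4Family) (θ : Stage13HParams F 2), θ.Provisos₁₃CoPH F 2 → (θ.ZhUnity F 2 ∧ θ.SlotsNondegenerate₁₃ F 2) → θ.Admissible F 2 →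
      0 < (li F θ).C₀ ∧ 0 < (li F θ).θ₅ ∧ (li F θ).θ₅ < 1 ∧ 0 ≤ (li F θ).C₅ ∧ 2 * (li F θ).C₅ / (1 - (li F θ).θ₅) ≤ (li F θ).C₀ ∧ 0 < (li F θ).A ∧
        (li F θ).θ₅ ≤ (li F θ).μ ∧ (li F θ).C₀ ≤ 2 * (li F θ).A ∧ 0 < (li F θ).r ∧ 0 < (li F θ).s ∧ (li F θ).s < 1 ∧ 1 ≤ (li F θ).μ)
    (hstrip : ∀ (F : T4Family) (θ : Stage13HParams F 2), θ.Provisos₁₃CoPH F 2 → (θ.ZhUnity F 2 ∧ θ.SlotsNondegenerate₁₃ F 2) → θ.Admissible F 2 → ∀ (k : ℕ),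
      ∀ (j : ℕ) (g : ℕ → ℝ), g ∈ Window θ.γ → ∀ (i : ℕ) (Y : (domSys (F.P k) θ.τ9.M j).Dom) (ψ : CPair (F.P k) (MatA 2)), ψ ∈ sp F θ k j Y →
        ∃ (Ec : ℂ → ℂ) (O : Set ℂ), IsOpen O ∧ (∀ t ∈ Ioc (0 : ℝ) θ.γ, closedBall (t : ℂ) (li F θ).r ⊆ O) ∧ DifferentiableOn ℂ Ec O ∧
          (∀ z ∈ O, ‖Ec z‖ ≤ (li F θ).A * Real.exp (-((li F θ).κ * torusTreeLen Y.1))) ∧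
          (∀ t ∈ Ioc (0 : ℝ) θ.γ, Ec t = termC (S F θ k) j Y (Function.update g i t) ψ))
    (hD4 : ∀ (F : T4Family) (θ : Stage13HParams F 2) (hP : θ.Provisos₁₃CoPH F 2), (θ.ZhUnity F 2 ∧ θ.SlotsNondegenerate₁₃ F 2) → θ.Admissible F 2 → ∀ k : ℕ,
      ReadOutAt (datumOfRecord₁₃CoPH F 2 θ hP) (u3OfRecord₁₃ θ.toStage13Params
        ((ReadingData.ofRecordAdm F θ.τ9.M 2 (S F θ) (sp F θ) (gauge F θ) (hg F θ) (T₀ F θ) (hT₀ F θ) (li F θ)).u3Objects θ.γ) k))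
    (h20 : S_N20 (SRec₁₃CoPHOn cr₁₃ fun F θ => θ.ZhUnity F 2 ∧ θ.SlotsNondegenerate₁₃ F 2)) (h21 : S_N21 (SRec₁₃CoPHOn cr₁₃ fun F θ => θ.ZhUnity F 2 ∧ θ.SlotsNondegenerate₁₃ F 2))
    (hx : ∀ (F : T4Family) (θ : Stage13HParams F 2) (hP : θ.Provisos₁₃CoPH F 2), (θ.ZhUnity F 2 ∧ θ.SlotsNondegenerate₁₃ F 2) → θ.Admissible F 2 →
      B16.EndStatementBPrinted (datumOfRecord₁₃CoPH F 2 θ hP).C → DagBinding.EndpointExistence (datumOfRecord₁₃CoPH F 2 θ hP).C.toB12 →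
        ForSmallCouplings (datumOfRecord₁₃CoPH F 2 θ hP) fun g₀ => ∀ os : List (ULoop F),
          0 < (cr₁₃ F θ hP g₀ os).l₀ ∧ 0 < (cr₁₃ F θ hP g₀ os).vol ∧
          (∀ (K : ℕ) (t : ℝ), |t| ≤ (cr₁₃ F θ hP g₀ os).l₀ →
            T4GenFunBounds.schemeZ ((datumOfRecord₁₃CoPH F 2 θ hP).scheme g₀) os ((cr₁₃ F θ hP g₀ os).K₀ + K) t =
              ∑ τ ∈ (cr₁₃ F θ hP g₀ os).T K, (cr₁₃ F θ hP g₀ os).A K t τ) ∧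
          (∀ (K : ℕ) (t : ℝ), |t| ≤ (cr₁₃ F θ hP g₀ os).l₀ →
            T4GenFunBounds.schemeZ ((datumOfRecord₁₃CoPH F 2 θ hP).scheme g₀) os ((cr₁₃ F θ hP g₀ os).K₀ + K + 1) t =
              ∑ τ ∈ (cr₁₃ F θ hP g₀ os).T K, (cr₁₃ F θ hP g₀ os).B K t τ))
    (h19 : ∀ (ℓ₃ : T4Family → NE3Letters₁₁) (F : T4Family) (θ : Stage13HParams F 2) (hP : θ.Provisos₁₃CoPH F 2), (θ.ZhUnity F 2 ∧ θ.SlotsNondegenerate₁₃ F 2) → θ.Admissible F 2 → ∀ (g₀ : ℕ → ℝ) (os : List (ULoop F)),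
      (∀ k : ℕ, RatesHolderAt (datumOfRecord₁₃CoPH F 2 θ hP) (rateCarriersOfRecord₁₃CoPH (readingOfRecord₁₃CoPH
        (fun F θ => ReadingData.ofRecordAdm F θ.τ9.M 2 (S F θ) (sp F θ) (gauge F θ) (hg F θ) (T₀ F θ) (hT₀ F θ) (li F θ)) ℓ₃ ne2 ne1) F θ hP g₀ os k) β) →
        letI := (cr₁₃ F θ hP g₀ os).dec
        ∃ δ : ℕ → ℝ, NE7.Core (cr₁₃ F θ hP g₀ os).l₀ (cr₁₃ F θ hP g₀ os).vol (cr₁₃ F θ hP g₀ os).T (cr₁₃ F θ hP g₀ os).Bad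
          (fun K t τ => (cr₁₃ F θ hP g₀ os).A K t τ - (cr₁₃ F θ hP g₀ os).shA K t τ) (fun K t τ => (cr₁₃ F θ hP g₀ os).B K t τ - (cr₁₃ F θ hP g₀ os).shB K t τ) δ ∧
          Summable δ)
    (hne2 : ∀ (F : T4Family) (θ : Stage13HParams F 2), θ.Provisos₁₃CoPH F 2 → θ.Admissible F 2 → ∀ (g₀ : ℕ → ℝ) (os : List (ULoop F)) (k : ℕ),
      ne2 F θ g₀ os k = haveI := neZero_blockFactor F; c2BgObjects 3 F.hL b aS α α' c35 p)
    (hne1 : ∀ (F : T4Family) (θ : Stage13HParams F 2) (hP : θ.Provisos₁₃CoPH F 2), θ.Admissible F 2 → ∀ (g₀ : ℕ → ℝ) (os : List (ULoop F)),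
      ne1 F θ g₀ os = ne1UnitScale l₀ M Λ hM F θ hP g₀ os) :
    SpineGivenEndpointR13SepCoPH :=
  fun F θ hP hG hθ _ _ =>
    (spine_rec13CCoPHOn_iff_forall_guarded fun F θ => θ.ZhUnity F 2 ∧ θ.SlotsNondegenerate₁₃ F 2).mp
      (spine_rec13CCoPHOn_at_readingAdm₁₃CoPH_holder_of_unitScaleN14_c2Bg_thm33Letters (cr := cr₁₃) hβ0 hβ1 (hg₃ := hg₃) (hD := hD) (h7 := h7) (S := S) (sp := sp)
        (gauge := gauge) (hg := hg) (T₀ := T₀) (hT₀ := hT₀) (li := li) (ne2 := ne2) (ne1 := ne1) (Rg := fun F θ => θ.ZhUnity F 2 ∧ θ.SlotsNondegenerate₁₃ F 2)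
        hl₀ hM hΛ hb haS hc35 α α' p h18 hjunk hnum hstrip hD4 h20 h21 hx h19 hne2 hne1) F θ hP.toCore hG hθ

end Summit.QuantumFields.YangMills.Theorems.BalabanUVNodesN27SpineRecord
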